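import Literature.Computability.AlgebraicComplexity.GLAnnihilator
import Literature.Computability.AlgebraicComplexity.DeterminantIrreducible
import HarnessLib

/-!
# The annihilator `𝔤𝔩(W)_{det_n}` has dimension at most `2n² − 2` (infinitesimal Frobenius theorem)

Topic `Literature/Computability/AlgebraicComplexity`; theorems only, no definition of record, no named
fact (cell `val-lit`, seat t13 g4; the «hard half» of the `det_n` stabilizer count that
`Bur24_dim_detOrbitClosure` — Bürgisser 2024 §7.2, `dim Ω_n = dim GL_{n²} − dim H = n⁴ − 2n² + 2` —
needs on top of the orbit-closure dimension engine `dim \overline{GL·P} = dim 𝔤𝔩(W)·P`).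
Honest framing: a classical dimension count; **`VP ≠ VNP` is NOT proved and nothing here bears on it.**

**Sources.** P. Bürgisser, *Completeness classes in algebraic complexity theory* (2024 survey),
arXiv:2406.06217, §7.1 eq. (7.1): the stabilizer `H` of `det_n` in `GL_{n²}` consists of the maps
`X ↦ AXB` (`det A · det B = 1`) and `X ↦ AXᵀB`, «`dim H = 2n² − 2`» (`paper:arxiv-2406.06217`
p0027.txt:L88–104). J. M. Landsberg, L. Manivel, N. Ressayre, Comment. Math. Helv. 88 (2013) §3.5
(p. 481): the stabilizer of `P_Λ` «has dimension `2n²`, which is one more than the dimension of the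
stabilizer of `[det_n]`» (so `dim 𝔤𝔩(W)_{det_n} = 2n² − 2`). The infinitesimal statement proved here —
every `X ∈ 𝔤𝔩(W)` with `X · det_n = 0` is determined by `2n² − 2` of its entries — is the Lie-algebra
shadow of Frobenius' 1897 theorem; the proof below is ours (coefficient comparison), no source prints it
in this form.

## What is proved

For `X ∈ glAnn (detPoly ι ℂ)` (t12's `GLAnnihilator.lean`: `∑_{a,b} X_{ab} x_a ∂_b det = 0`; any finite
index type `ι` of rows = columns), writing cells as `a = (k, l)`, `b = (i, j)` and `o` for a reference
index (namespace `DetAnnUpper`):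

* `entry_eq_zero_of_ne_of_ne` — `k ≠ i`, `l ≠ j` ⟹ `X_{(k,l),(i,j)} = 0`;
* `entry_eq_zero_of_row_ref` — `l ≠ j`, `i ≠ o`, `X_{(o,l),(o,j)} = 0` ⟹ `X_{(i,l),(i,j)} = 0` (the
  column Laplace relations are the only syzygies of this type);
* `entry_eq_zero_of_col_ref` — `k ≠ i`, `j ≠ o`, `X_{(k,o),(i,o)} = 0` ⟹ `X_{(k,j),(i,j)} = 0` (row
  Laplace; by the transposition symmetry `swap_mem_glAnn_detPoly`);
* `sum_diag_perm_eq_zero` — `∑_c X_{(πc,c),(πc,c)} = 0` for every permutation `π`; `exchange` and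
  `diag_eq_zero` — hence the diagonal block `β_{rc} := X_{(r,c),(r,c)}` (indices `Fin (m+1)`) vanishes
  as soon as it vanishes on the `2m` cells `(r+1, 0)` and `(0, c)`, `c ≠ last`;
* `finrank_glAnn_detPoly_succ_le` and **`finrank_glAnn_detPoly_le`** (root namespace of the topic) —
  `Module.finrank ℂ (glAnn (detPoly (Fin n) ℂ)) ≤ 2 * n ^ 2 - 2` for all `n`, via the linear map
  recording the `2n² − 2` reference entries, injective on `glAnn det_n`;
* `finrank_glTangent_detPoly_ge` — `n ^ 4 - (2 * n ^ 2 - 2) ≤ finrank (glTangent det_n)` by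
  rank–nullity (`finrank_glTangent_add_finrank_glAnn`).

Two proof-plumbing definitions (`DetAnnUpper.sgn`, the sign of a permutation in `ℂ`, and
`DetAnnUpper.D`, the exponent vector of a term of `x_a ∂_b det`); no definition of record, no named
fact, no `instance`, no `notation`.

## Proof

`x_a ∂_b det_n = ∑_{π : π j = i} sgn(π) x^{D(a,π,b)}` with `D(a,π,b) = e_a + (μ_π − e_b)` (`μ_π` the
permutation monomial `∏_c x_{(πc, c)}`). The exponent `D(a,π,b)` takes `[r = k] + [r ≠ i]` variables from
row `r` and `[c = l] + [c ≠ j]` from column `c`; so the coefficient of a monomial in `X · det_n`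
only involves the pairs `(a, b)` of one row/column type, and within a type the permutation is recovered
from the monomial. Four monomial families then give: a single term (`k ≠ i, l ≠ j`), two terms of
opposite sign (a doubled column or row: the Laplace/Cramer relations `∑_i x_{il} ∂_{ij} det = δ_{lj} det`),
and the permutation monomials (`∑_c X_{(πc,c),(πc,c)} = 0`), which are solved by the exchange relation
`β_{πu,u} + β_{πv,v} = β_{πv,u} + β_{πu,v}`.

## References

* [Burgisser2024Completeness] P. Bürgisser, arXiv:2406.06217, §7.1 eq. (7.1), §7.2.
* [LandsbergManivelRessayre2013] J. M. Landsberg, L. Manivel, N. Ressayre, Comment. Math. Helv. 88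
  (2013) 469–484, §3.5 (p. 481).
-/

noncomputable section

namespace Literature.Computability.AlgebraicComplexity

open MvPolynomial Matrix Equiv

namespace DetAnnUpper

/-! ### The exponent vectors of `x_a ∂_b det` -/

section Exponents

variable {ι : Type*} [Fintype ι] [DecidableEq ι]

/-- The sign of a permutation as a complex number. [folklore] -/
def sgn (π : Perm ι) : ℂ := (((Perm.sign π : ℤˣ) : ℤ) : ℂ)

/-- `sgn π ≠ 0`. [folklore] -/
private theorem sgn_ne_zero (π : Perm ι) : sgn π ≠ 0 := intCast_sign_ne_zero ℂ π

/-- `sgn (π * swap u v) = - sgn π` for `u ≠ v`. [folklore] -/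
private theorem sgn_mul_swap (π : Perm ι) {u v : ι} (h : u ≠ v) : sgn (π * swap u v) = -sgn π := by
  simp [sgn, Perm.sign_mul, Perm.sign_swap h]

/-- The exponent vector `D(a,π,b) = e_a + (μ_π − e_b)` of the term of `x_a ∂_b det` indexed by the
permutation `π` (meaningful when `π b.2 = b.1`, i.e. `x_b ∣ x^{μ_π}`). [folklore] -/
def D (a : ι × ι) (π : Perm ι) (b : ι × ι) : (ι × ι) →₀ ℕ :=
  Finsupp.single a 1 + (permMonomial π - Finsupp.single b 1)

/-- Values of `D(a,π,b)`: `[q = a] + [q ≠ b]·[π q.2 = q.1]` when `π b.2 = b.1`. [folklore] -/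
private theorem D_apply {a b : ι × ι} {π : Perm ι} (hπ : π b.2 = b.1) (q : ι × ι) :
    D a π b q = (if a = q then 1 else 0) + (if b = q then 0 else if π q.2 = q.1 then 1 else 0) := by
  obtain ⟨r, c⟩ := q
  have h1 : (Finsupp.single a 1 : (ι × ι) →₀ ℕ) (r, c) = if a = (r, c) then 1 else 0 := by
    rw [Finsupp.single_apply]
  have h2 : (permMonomial π - Finsupp.single b 1 : (ι × ι) →₀ ℕ) (r, c) =
      if b = (r, c) then 0 else if π c = r then 1 else 0 := by
    rw [Finsupp.tsub_apply, permMonomial_apply, Finsupp.single_apply]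
    by_cases hq : b = (r, c)
    · subst hq
      simp only at hπ
      rw [if_pos hπ, if_pos rfl, if_pos rfl]
    · rw [if_neg hq, if_neg hq, Nat.sub_zero]
  rw [D, Finsupp.add_apply, h1, h2]

/-- Row counts of `D(a,π,b)`: `[r = a.1] + [r ≠ b.1]`. [folklore] -/
private theorem rowCount_D {a b : ι × ι} {π : Perm ι} (hπ : π b.2 = b.1) (r : ι) :
    rowCount (D a π b) r = (if a.1 = r then 1 else 0) + (if b.1 = r then 0 else 1) := by
  simp only [rowCount, D_apply hπ, Finset.sum_add_distrib]
  obtain ⟨a1, a2⟩ := a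
  obtain ⟨b1, b2⟩ := b
  simp only at hπ
  congr 1
  · simp only [Prod.mk.injEq]
    by_cases h : a1 = r
    · simp [h]
    · simp [h]
  · simp only [Prod.mk.injEq]
    by_cases hr : b1 = r
    · subst hr
      rw [if_pos rfl]
      refine Finset.sum_eq_zero fun c _ => ?_
      by_cases hc : b2 = c
      · rw [if_pos ⟨rfl, hc⟩]
      · rw [if_neg (fun h => hc h.2), if_neg]
        intro h
        exact hc (π.injective (hπ.trans h.symm))
    · rw [if_neg hr, Finset.sum_eq_single (π.symm r)]
      · rw [if_neg (fun h => hr h.1), if_pos (π.apply_symm_apply r)]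
      · intro c _ hc
        have : π c ≠ r := fun h => hc (by rw [← h, Equiv.symm_apply_apply])
        rw [if_neg this]
        split_ifs <;> rfl
      · simp

/-- Column counts of `D(a,π,b)`: `[c = a.2] + [c ≠ b.2]`. [folklore] -/
private theorem colCount_D {a b : ι × ι} {π : Perm ι} (hπ : π b.2 = b.1) (c : ι) :
    colCount (D a π b) c = (if a.2 = c then 1 else 0) + (if b.2 = c then 0 else 1) := by
  simp only [colCount, D_apply hπ, Finset.sum_add_distrib]
  obtain ⟨a1, a2⟩ := a
  obtain ⟨b1, b2⟩ := b
  simp only at hπ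
  congr 1
  · simp only [Prod.mk.injEq]
    by_cases h : a2 = c
    · simp [h]
    · simp [h]
  · simp only [Prod.mk.injEq]
    by_cases hc : b2 = c
    · subst hc
      rw [if_pos rfl]
      refine Finset.sum_eq_zero fun r _ => ?_
      by_cases hr : b1 = r
      · rw [if_pos ⟨hr, rfl⟩]
      · rw [if_neg (fun h => hr h.1), if_neg]
        intro h
        exact hr (hπ.symm.trans h)
    · rw [if_neg hc, Finset.sum_eq_single (π c)]
      · rw [if_neg (fun h => hc h.2), if_pos rfl]
      · intro r _ hr
        rw [if_neg (Ne.symm hr)]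
        split_ifs <;> rfl
      · simp

omit [Fintype ι] in
/-- The signature function `r ↦ [r = p] + [r ≠ q]` determines `(p, q)` when `p ≠ q`, and detects
`p = q`. [folklore] -/
private theorem sig_inj {p q p' q' : ι}
    (h : ∀ r : ι, (if p = r then 1 else 0) + (if q = r then 0 else 1) =
      ((if p' = r then 1 else 0) + (if q' = r then 0 else 1) : ℕ)) :
    (p ≠ q → p' = p ∧ q' = q) ∧ (p = q → p' = q') := by
  constructor
  · intro hpq
    have hq := h q
    have hp := h p
    rw [if_neg hpq, if_pos rfl] at hq
    rw [if_pos rfl, if_neg (Ne.symm hpq)] at hp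
    constructor
    · by_contra h'
      rw [if_neg h'] at hp
      split_ifs at hp <;> omega
    · by_contra h'
      rw [if_neg h'] at hq
      split_ifs at hq <;> omega
  · intro hpq
    subst hpq
    have hp' := h p'
    by_contra h'
    rw [if_pos rfl, if_neg (show ¬(q' = p') from fun e => h' e.symm)] at hp'
    split_ifs at hp' <;> omega

/-- **Type separation.** If `D(a',π',b') = D(a,π,b)` then the row data agree: `a.1 ≠ b.1` forces
`a'.1 = a.1, b'.1 = b.1`, and `a.1 = b.1` forces `a'.1 = b'.1`; likewise for columns. [folklore] -/
private theorem fiber_type {a b a' b' : ι × ι} {π π' : Perm ι} (hπ : π b.2 = b.1) (hπ' : π' b'.2 = b'.1)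
    (h : D a' π' b' = D a π b) :
    ((a.1 ≠ b.1 → a'.1 = a.1 ∧ b'.1 = b.1) ∧ (a.1 = b.1 → a'.1 = b'.1)) ∧
      ((a.2 ≠ b.2 → a'.2 = a.2 ∧ b'.2 = b.2) ∧ (a.2 = b.2 → a'.2 = b'.2)) := by
  constructor
  · refine sig_inj fun r => ?_
    rw [← rowCount_D hπ r, ← rowCount_D hπ' r, h]
  · refine sig_inj fun c => ?_
    rw [← colCount_D hπ c, ← colCount_D hπ' c, h]

/-- Within a type the permutation is recovered: `D(a,π',b) = D(a,π,b)` forces `π' = π`. [folklore] -/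
private theorem fiber_perm {a b : ι × ι} {π π' : Perm ι} (hπ : π b.2 = b.1) (hπ' : π' b.2 = b.1)
    (h : D a π' b = D a π b) : π' = π := by
  ext c
  by_cases hc : c = b.2
  · rw [hc, hπ, hπ']
  · have hq := DFunLike.congr_fun h (π' c, c)
    have hne : b ≠ (π' c, c) := fun h' => hc (by rw [h'])
    rw [D_apply hπ', D_apply hπ, if_neg hne, if_neg hne] at hq
    dsimp only at hq
    rw [if_pos rfl] at hq
    by_cases h' : π c = π' c
    · exact h'.symm
    · rw [if_neg h'] at hq
      omega

end Exponents

/-! ### Coefficients of `X · det` -/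

section Coefficients

variable {ι : Type*} [Fintype ι] [DecidableEq ι]

/-- `x_a ∂_b det = ∑_π [π b.2 = b.1] sgn(π) x^{D(a,π,b)}` (Leibniz expansion, differentiated).
[cite: LandsbergManivelRessayre2013, §3.4 (p. 479)] -/
theorem X_mul_pderiv_detPoly (a b : ι × ι) :
    MvPolynomial.X a * pderiv b (detPoly ι ℂ) =
      ∑ π : Perm ι, monomial (D a π b) (if π b.2 = b.1 then sgn π else 0) := by
  obtain ⟨i, j⟩ := b
  rw [detPoly_eq_sum_monomial, map_sum, Finset.mul_sum]
  refine Finset.sum_congr rfl fun π _ => ?_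
  rw [pderiv_monomial, show (MvPolynomial.X a : MvPolynomial (ι × ι) ℂ) =
      monomial (Finsupp.single a 1) 1 from rfl, monomial_mul, one_mul, permMonomial_apply]
  simp only [D, sgn, Nat.cast_ite, Nat.cast_one, Nat.cast_zero, mul_ite, mul_one, mul_zero]

/-- **Coefficient formula**: the coefficient of `x^t` in `X · det = ∑_{a,b} X_{ab} x_a ∂_b det` is
`∑ X_{ab} sgn(π)` over the triples `(a, b, π)` with `π b.2 = b.1` and `D(a,π,b) = t`. [cite: LandsbergManivelRessayre2013, §3.4 (p. 479)] -/
theorem coeff_glTangentMap_detPoly (t : (ι × ι) →₀ ℕ) (M : Matrix (ι × ι) (ι × ι) ℂ) :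
    coeff t (glTangentMap (detPoly ι ℂ) M) =
      ∑ a, ∑ b, ∑ π : Perm ι, if π b.2 = b.1 ∧ D a π b = t then M a b * sgn π else 0 := by
  rw [glTangentMap_apply, coeff_sum]
  refine Finset.sum_congr rfl fun a _ => ?_
  rw [coeff_sum]
  refine Finset.sum_congr rfl fun b _ => ?_
  rw [coeff_smul, X_mul_pderiv_detPoly, coeff_sum, smul_eq_mul, Finset.mul_sum]
  refine Finset.sum_congr rfl fun π _ => ?_
  rw [coeff_monomial]
  by_cases h1 : π b.2 = b.1 <;> by_cases h2 : D a π b = t <;> simp [h1, h2]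

/-! ### Type IV: `k ≠ i`, `l ≠ j` — a single term -/

/-- For `k ≠ i` and `l ≠ j` the monomial `x^{D((k,l), (i j), (i,j))}` occurs in `X · det_n` with
coefficient `± X_{(k,l),(i,j)}` (no other pair `(a, b)` has this row/column type, and the permutation
is forced). [folklore] -/
private theorem coeff_typeIV {k l i j : ι} (hki : k ≠ i) (hlj : l ≠ j) (M : Matrix (ι × ι) (ι × ι) ℂ) :
    coeff (D (k, l) (swap i j) (i, j)) (glTangentMap (detPoly ι ℂ) M) =
      M (k, l) (i, j) * sgn (swap i j) := by
  rw [coeff_glTangentMap_detPoly]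
  have hπ : (swap i j) (i, j).2 = (i, j).1 := swap_apply_right i j
  rw [Finset.sum_eq_single (k, l)]
  · rw [Finset.sum_eq_single (i, j)]
    · rw [Finset.sum_eq_single (swap i j)]
      · rw [if_pos ⟨hπ, rfl⟩]
      · intro π _ hne
        rw [if_neg]
        rintro ⟨h1, h2⟩
        exact hne (fiber_perm hπ h1 h2)
      · simp
    · intro b _ hb
      refine Finset.sum_eq_zero fun π _ => ?_
      rw [if_neg]
      rintro ⟨h1, h2⟩
      obtain ⟨⟨hr, -⟩, ⟨hc, -⟩⟩ := fiber_type hπ h1 h2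
      exact hb (Prod.ext (hr hki).2 (hc hlj).2)
    · simp
  · intro a _ ha
    refine Finset.sum_eq_zero fun b _ => Finset.sum_eq_zero fun π _ => ?_
    rw [if_neg]
    rintro ⟨h1, h2⟩
    obtain ⟨⟨hr, -⟩, ⟨hc, -⟩⟩ := fiber_type hπ h1 h2
    exact ha (Prod.ext (hr hki).1 (hc hlj).1)
  · simp

/-- **Type IV vanishing**: for `X ∈ 𝔤𝔩(W)_{det}` the entries `X_{(k,l),(i,j)}` with `k ≠ i`, `l ≠ j`
vanish. [cite: Burgisser2024Completeness, §7.1 eq. (7.1)] -/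
theorem entry_eq_zero_of_ne_of_ne {M : Matrix (ι × ι) (ι × ι) ℂ} (hM : M ∈ glAnn (detPoly ι ℂ))
    {k l i j : ι} (hki : k ≠ i) (hlj : l ≠ j) : M (k, l) (i, j) = 0 := by
  have h := coeff_typeIV hki hlj M
  rw [(mem_glAnn_iff_glTangentMap_eq_zero _ _).1 hM, coeff_zero] at h
  exact (mul_eq_zero.1 h.symm).resolve_right (sgn_ne_zero _)

/-! ### Type I: the permutation monomials -/

/-- `D(a,π,a) = μ_π` when `x_a ∣ x^{μ_π}`. [folklore] -/
private theorem D_self {a : ι × ι} {π : Perm ι} (hπ : π a.2 = a.1) : D a π a = permMonomial π := by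
  ext q
  obtain ⟨r, c⟩ := q
  rw [D_apply hπ, permMonomial_apply]
  by_cases h : a = (r, c)
  · subst h
    simp only at hπ
    rw [if_pos rfl, if_pos rfl, if_pos hπ]
  · rw [if_neg h, if_neg h, zero_add]

/-- The permutation monomial `x^{μ_π}` arises only from the pairs `a = b` dividing it, with the
permutation `π` itself. [folklore] -/
private theorem fiber_permMonomial {π π' : Perm ι} {a b : ι × ι} (hπ' : π' b.2 = b.1)
    (h : D a π' b = permMonomial π) : a = b ∧ π' = π := by
  have hrow : a.1 = b.1 := by
    by_contra hne
    have h1 := rowCount_D (a := a) hπ' a.1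
    rw [h, rowCount_permMonomial, if_pos rfl, if_neg (Ne.symm hne)] at h1
    omega
  have hcol : a.2 = b.2 := by
    by_contra hne
    have h1 := colCount_D (a := a) hπ' a.2
    rw [h, colCount_permMonomial, if_pos rfl, if_neg (Ne.symm hne)] at h1
    omega
  have hab : a = b := Prod.ext hrow hcol
  subst hab
  exact ⟨rfl, permMonomial_injective (by rw [← D_self hπ', h])⟩

/-- The coefficient of the permutation monomial `x^{μ_π}` in `X · det_n` is
`sgn(π) ∑_c X_{(πc,c),(πc,c)}`. [cite: Burgisser2024Completeness, §7.1 eq. (7.1)] -/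
theorem coeff_permMonomial_glTangentMap (π : Perm ι) (M : Matrix (ι × ι) (ι × ι) ℂ) :
    coeff (permMonomial π) (glTangentMap (detPoly ι ℂ) M) = sgn π * ∑ c, M (π c, c) (π c, c) := by
  rw [coeff_glTangentMap_detPoly]
  have key : ∀ a : ι × ι, (∑ b, ∑ π' : Perm ι,
      if π' b.2 = b.1 ∧ D a π' b = permMonomial π then M a b * sgn π' else 0) =
      if π a.2 = a.1 then M a a * sgn π else 0 := by
    intro a
    by_cases ha : π a.2 = a.1
    · rw [if_pos ha, Finset.sum_eq_single a]
      · rw [Finset.sum_eq_single π]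
        · rw [if_pos ⟨ha, D_self ha⟩]
        · intro π' _ hne
          rw [if_neg]
          rintro ⟨h1, h2⟩
          exact hne (fiber_permMonomial h1 h2).2
        · simp
      · intro b _ hb
        refine Finset.sum_eq_zero fun π' _ => ?_
        rw [if_neg]
        rintro ⟨h1, h2⟩
        exact hb (fiber_permMonomial h1 h2).1.symm
      · simp
    · rw [if_neg ha]
      refine Finset.sum_eq_zero fun b _ => Finset.sum_eq_zero fun π' _ => ?_
      rw [if_neg]
      rintro ⟨h1, h2⟩
      obtain ⟨hab, hππ⟩ := fiber_permMonomial h1 h2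
      subst hab hππ
      exact ha h1
  simp_rw [key]
  rw [Finset.mul_sum, Fintype.sum_prod_type, Finset.sum_comm]
  refine Finset.sum_congr rfl fun c _ => ?_
  simp only
  rw [Finset.sum_ite_eq, if_pos (Finset.mem_univ _), mul_comm]

/-- **Type I relations**: for `X ∈ 𝔤𝔩(W)_{det}` and every permutation `π`,
`∑_c X_{(πc,c),(πc,c)} = 0`. [cite: Burgisser2024Completeness, §7.1 eq. (7.1)] -/
theorem sum_diag_perm_eq_zero {M : Matrix (ι × ι) (ι × ι) ℂ} (hM : M ∈ glAnn (detPoly ι ℂ))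
    (π : Perm ι) : ∑ c, M (π c, c) (π c, c) = 0 := by
  have h := coeff_permMonomial_glTangentMap π M
  rw [(mem_glAnn_iff_glTangentMap_eq_zero _ _).1 hM, coeff_zero] at h
  exact (mul_eq_zero.1 h.symm).resolve_left (sgn_ne_zero π)


/-! ### Type II: a doubled column — the Laplace relations -/

/-- Fibre of a type II monomial: for `i ≠ o`, `l ≠ j` and `π₁` with `π₁ j = i`, `π₁ l = o`, the
exponent `D((i,l),π₁,(i,j))` (column `l` doubled in rows `i, o`, column `j` empty) arises exactly from
the two triples `((i,l),(i,j),π₁)` and `((o,l),(o,j),π₁·(j l))`. [folklore] -/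
private theorem fiber_typeII {o i l j : ι} (hio : i ≠ o) (hlj : l ≠ j) {π₁ : Perm ι} (h1 : π₁ j = i)
    (h2 : π₁ l = o) {a b : ι × ι} {π : Perm ι} (hπ : π b.2 = b.1)
    (h : D a π b = D (i, l) π₁ (i, j)) :
    (a = (i, l) ∧ b = (i, j) ∧ π = π₁) ∨ (a = (o, l) ∧ b = (o, j) ∧ π = π₁ * swap j l) := by
  have hπ₁ : π₁ (i, j).2 = (i, j).1 := h1
  obtain ⟨⟨-, hr⟩, ⟨hc, -⟩⟩ := fiber_type hπ₁ hπ h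
  obtain ⟨hal, hbj⟩ := hc hlj
  have hab : a.1 = b.1 := hr rfl
  obtain ⟨i', l'⟩ := a
  obtain ⟨i'', j'⟩ := b
  simp only at hal hbj hab hπ
  subst l' j' i''
  -- now `a = (i', l)`, `b = (i', j)`, `π j = i'`
  have hval : ∀ r : ι, (if i' = r then 1 else 0) + (if π l = r then 1 else 0) =
      ((if i = r then 1 else 0) + (if o = r then 1 else 0) : ℕ) := by
    intro r
    have hq := DFunLike.congr_fun h (r, l)
    rw [D_apply hπ, D_apply hπ₁] at hq
    have e1 : ¬ (i', j) = (r, l) := fun e => hlj (Prod.ext_iff.1 e).2.symm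
    have e2 : ¬ (i, j) = (r, l) := fun e => hlj (Prod.ext_iff.1 e).2.symm
    rw [if_neg e1, if_neg e2, h2] at hq
    simpa only [Prod.mk.injEq, and_true] using hq
  have hrest : ∀ c, c ≠ j → c ≠ l → π c = π₁ c := by
    intro c hcj hcl
    have hq := DFunLike.congr_fun h (π c, c)
    rw [D_apply hπ, D_apply hπ₁] at hq
    have e1 : ¬ (i', l) = (π c, c) := fun e => hcl (Prod.ext_iff.1 e).2.symm
    have e2 : ¬ (i', j) = (π c, c) := fun e => hcj (Prod.ext_iff.1 e).2.symm
    have e3 : ¬ (i, l) = (π c, c) := fun e => hcl (Prod.ext_iff.1 e).2.symm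
    have e4 : ¬ (i, j) = (π c, c) := fun e => hcj (Prod.ext_iff.1 e).2.symm
    rw [if_neg e1, if_neg e2, if_neg e3, if_neg e4, zero_add, zero_add] at hq
    dsimp only at hq
    rw [if_pos rfl] at hq
    by_contra hne
    rw [if_neg (show ¬ π₁ c = π c from fun e => hne e.symm)] at hq
    exact one_ne_zero hq
  by_cases hi : i' = i
  · subst hi
    left
    refine ⟨rfl, rfl, ?_⟩
    have hπlo : π l = o := by
      have := hval o
      rw [if_neg hio, if_pos rfl, zero_add, zero_add] at this
      by_contra hne
      rw [if_neg hne] at this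
      exact zero_ne_one this
    ext c
    by_cases hcj : c = j
    · rw [hcj, hπ, h1]
    by_cases hcl : c = l
    · rw [hcl, hπlo, h2]
    exact hrest c hcj hcl
  · right
    have hπli : π l = i := by
      have := hval i
      rw [if_neg hi, if_pos rfl, zero_add] at this
      by_contra hne
      rw [if_neg hne] at this
      split_ifs at this
      omega
    have hi'o : i' = o := by
      by_contra hne
      have := hval o
      rw [if_neg hio, if_pos rfl, zero_add, if_neg hne, zero_add, hπli, if_neg hio] at this
      exact zero_ne_one this
    subst hi'o
    refine ⟨rfl, rfl, ?_⟩
    ext c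
    rw [Perm.mul_apply]
    by_cases hcj : c = j
    · rw [hcj, swap_apply_left, hπ, h2]
    by_cases hcl : c = l
    · rw [hcl, swap_apply_right, hπli, h1]
    rw [swap_apply_of_ne_of_ne hcj hcl]
    exact hrest c hcj hcl

/-- **Type II vanishing relative to the reference row**: for `X ∈ 𝔤𝔩(W)_{det}`, `l ≠ j`, `i ≠ o`:
`X_{(o,l),(o,j)} = 0 ⟹ X_{(i,l),(i,j)} = 0` (the coefficient of the type II monomial is
`± (X_{(i,l),(i,j)} − X_{(o,l),(o,j)})`: the column Laplace relation is the only syzygy of this type).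
[cite: Burgisser2024Completeness, §7.1 eq. (7.1)] -/
theorem entry_eq_zero_of_row_ref {M : Matrix (ι × ι) (ι × ι) ℂ} (hM : M ∈ glAnn (detPoly ι ℂ))
    {o i l j : ι} (hio : i ≠ o) (hlj : l ≠ j) (href : M (o, l) (o, j) = 0) :
    M (i, l) (i, j) = 0 := by
  -- a permutation with `π₁ j = i`, `π₁ l = o`
  set s : Perm ι := swap l o with hs
  set π₁ : Perm ι := swap (s j) i * s with hπ₁
  have hsl : s l = o := swap_apply_left l o
  have hsj : s j ≠ o := by
    intro e
    exact hlj (s.injective (hsl.trans e.symm))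
  have h1 : π₁ j = i := by rw [hπ₁, Perm.mul_apply, swap_apply_left]
  have h2 : π₁ l = o := by
    rw [hπ₁, Perm.mul_apply, hsl, swap_apply_of_ne_of_ne (Ne.symm hsj) (Ne.symm hio)]
  have hcoeff := coeff_glTangentMap_detPoly (D (i, l) π₁ (i, j)) M
  rw [(mem_glAnn_iff_glTangentMap_eq_zero _ _).1 hM, coeff_zero] at hcoeff
  -- every term other than the one at `((i,l),(i,j),π₁)` vanishes
  have hterm : ∀ (a b : ι × ι) (π : Perm ι), ¬ (a = (i, l) ∧ b = (i, j) ∧ π = π₁) →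
      (if π b.2 = b.1 ∧ D a π b = D (i, l) π₁ (i, j) then M a b * sgn π else 0) = 0 := by
    intro a b π hne
    split_ifs with hc
    · rcases fiber_typeII hio hlj h1 h2 hc.1 hc.2 with h | ⟨rfl, rfl, -⟩
      · exact absurd h hne
      · rw [href, zero_mul]
    · rfl
  rw [Finset.sum_eq_single (i, l), Finset.sum_eq_single (i, j), Finset.sum_eq_single π₁,
    if_pos ⟨h1, rfl⟩] at hcoeff
  · exact (mul_eq_zero.1 hcoeff.symm).resolve_right (sgn_ne_zero _)
  · intro π _ hne; exact hterm _ _ _ fun h => hne h.2.2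
  · simp
  · intro b _ hne; exact Finset.sum_eq_zero fun π _ => hterm _ _ _ fun h => hne h.2.1
  · simp
  · intro a _ hne
    exact Finset.sum_eq_zero fun b _ => Finset.sum_eq_zero fun π _ => hterm _ _ _ fun h => hne h.1
  · simp

/-! ### Type III by transposition symmetry -/

/-- `det` is invariant under transposing the variables. [cite: Burgisser2024Completeness, §7.1 eq. (7.1)] -/
theorem rename_swap_detPoly : rename Prod.swap (detPoly ι ℂ) = detPoly ι ℂ := by
  unfold detPoly
  rw [AlgHom.map_det]
  have : (rename (Prod.swap : ι × ι → ι × ι)).mapMatrix (Matrix.mvPolynomialX ι ι ℂ) =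
      Matrix.transpose (Matrix.mvPolynomialX ι ι ℂ) := by
    ext i j : 2
    simp [Matrix.mvPolynomialX_apply, Matrix.transpose_apply]
  rw [this, Matrix.det_transpose]

/-- **Transposition symmetry of the annihilator**: if `X ∈ 𝔤𝔩(W)_{det}` then so is
`(a, b) ↦ X_{aᵀ bᵀ}` (because `det(xᵀ) = det(x)`). [cite: Burgisser2024Completeness, §7.1 eq. (7.1)] -/
theorem swap_mem_glAnn_detPoly {M : Matrix (ι × ι) (ι × ι) ℂ} (hM : M ∈ glAnn (detPoly ι ℂ)) :
    (Matrix.of fun a b : ι × ι => M a.swap b.swap) ∈ glAnn (detPoly ι ℂ) := by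
  rw [mem_glAnn_iff_glTangentMap_eq_zero] at hM ⊢
  have key : glTangentMap (detPoly ι ℂ) (Matrix.of fun a b : ι × ι => M a.swap b.swap) =
      rename Prod.swap (glTangentMap (detPoly ι ℂ) M) := by
    rw [glTangentMap_apply, glTangentMap_apply, map_sum]
    refine Fintype.sum_equiv (Equiv.prodComm ι ι) _ _ fun a => ?_
    rw [map_sum]
    refine Fintype.sum_equiv (Equiv.prodComm ι ι) _ _ fun b => ?_
    simp only [map_smul, map_mul, rename_X, Matrix.of_apply, Equiv.prodComm_apply, Prod.swap_swap]
    rw [← pderiv_rename Prod.swap_injective, rename_swap_detPoly, Prod.swap_swap]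
  rw [key, hM, map_zero]

/-- **Type III vanishing relative to the reference column**: for `X ∈ 𝔤𝔩(W)_{det}`, `k ≠ i`,
`j ≠ o`: `X_{(k,o),(i,o)} = 0 ⟹ X_{(k,j),(i,j)} = 0` (row Laplace relations; the transpose of
type II). [cite: Burgisser2024Completeness, §7.1 eq. (7.1)] -/
theorem entry_eq_zero_of_col_ref {M : Matrix (ι × ι) (ι × ι) ℂ} (hM : M ∈ glAnn (detPoly ι ℂ))
    {o k i j : ι} (hjo : j ≠ o) (hki : k ≠ i) (href : M (k, o) (i, o) = 0) :
    M (k, j) (i, j) = 0 :=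
  entry_eq_zero_of_row_ref (swap_mem_glAnn_detPoly hM) (i := j) (l := k) (j := i) hjo hki href

end Coefficients

/-! ### Solving the type I relations -/

section Diagonal

variable {ι : Type*} [Fintype ι] [DecidableEq ι]

/-- **Exchange relation**: if `∑_c β(πc, c) = 0` for all permutations `π`, then
`β(πu,u) + β(πv,v) = β(πv,u) + β(πu,v)` (compare `π` with `π · (u v)`). [folklore] -/
private theorem exchange {β : ι → ι → ℂ} (hE : ∀ π : Perm ι, ∑ c, β (π c) c = 0) (π : Perm ι) {u v : ι}
    (huv : u ≠ v) : β (π u) u + β (π v) v = β (π v) u + β (π u) v := by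
  have h := hE π
  have h' := hE (π * swap u v)
  have hsplit : ∑ c, (β (π c) c - β ((π * swap u v) c) c) =
      (β (π u) u - β ((π * swap u v) u) u) + (β (π v) v - β ((π * swap u v) v) v) := by
    rw [Fintype.sum_eq_add u v huv]
    intro c hc
    rw [Perm.mul_apply, swap_apply_of_ne_of_ne hc.1 hc.2, sub_self]
  rw [Finset.sum_sub_distrib, h, h', sub_zero, Perm.mul_apply, Perm.mul_apply, swap_apply_left,
    swap_apply_right] at hsplit
  linear_combination -hsplit

/-- **The diagonal block vanishes on the reference data**: if `β : Fin (m+1) × Fin (m+1) → ℂ`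
satisfies all permutation relations `∑_c β(πc,c) = 0` and vanishes on the `2m` reference cells
`(r+1, 0)` and `(0, c)`, `c ≠ last`, then `β = 0`. (For `m + 1 = 2` the cells `(1,0), (0,1)` would NOT
do: `β = [[a,b],[-b,-a]]`; hence the corner `(0,0)` is a reference cell and `(0, last)` is not.)
[folklore] -/
private theorem diag_eq_zero {m : ℕ} {β : Fin (m + 1) → Fin (m + 1) → ℂ}
    (hE : ∀ π : Perm (Fin (m + 1)), ∑ c, β (π c) c = 0)
    (hcol : ∀ r : Fin m, β r.succ 0 = 0) (hrow : ∀ c : Fin m, β 0 c.castSucc = 0)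
    (r c : Fin (m + 1)) : β r c = 0 := by
  have h1 := hE 1
  simp only [Perm.one_apply] at h1
  -- column `0`
  have hc0 : ∀ r : Fin (m + 1), r ≠ 0 → β r 0 = 0 := by
    intro r hr
    obtain ⟨r', rfl⟩ := Fin.exists_succ_eq.2 hr
    exact hcol r'
  -- row `0` off the last column
  have hr0 : ∀ c : Fin (m + 1), c ≠ Fin.last m → β 0 c = 0 := by
    intro c hc
    obtain ⟨c', rfl⟩ := Fin.exists_castSucc_eq.2 hc
    exact hrow c'
  -- the corner
  have h00 : β 0 0 = 0 := by
    rcases Nat.eq_zero_or_pos m with hm | hm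
    · subst hm
      simpa using h1
    · refine hr0 0 fun h => ?_
      have := congrArg Fin.val h
      rw [Fin.val_zero, Fin.val_last] at this
      omega
  -- the diagonal equals row `0`
  have hdiag : ∀ c, β c c = β 0 c := by
    intro c
    by_cases hc : c = 0
    · rw [hc]
    · have := exchange hE 1 (u := 0) (v := c) (Ne.symm hc)
      simp only [Perm.one_apply] at this
      rw [h00, hc0 c hc, zero_add, zero_add] at this
      exact this
  -- row `0` at the last column, from `∑_c β(c,c) = 0`
  have hlast : β 0 (Fin.last m) = 0 := by
    have hsum : ∑ c, β 0 c = 0 := by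
      rw [← h1]
      exact Finset.sum_congr rfl fun c _ => (hdiag c).symm
    rw [Fin.sum_univ_castSucc, Finset.sum_eq_zero (fun c _ => hrow c), zero_add] at hsum
    exact hsum
  have hrow0 : ∀ c, β 0 c = 0 := fun c =>
    if hc : c = Fin.last m then hc ▸ hlast else hr0 c hc
  -- a general cell
  by_cases hr : r = 0
  · rw [hr]; exact hrow0 c
  by_cases hc : c = 0
  · rw [hc]; exact hc0 r hr
  by_cases hrc : r = c
  · rw [hrc, hdiag, hrow0]
  · have := exchange hE (swap r c) (u := c) (v := 0) hc
    rw [swap_apply_right, swap_apply_of_ne_of_ne (Ne.symm hr) (Ne.symm hc), h00,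
      hrow0 c, hc0 r hr, add_zero, zero_add] at this
    exact this

end Diagonal

/-! ### The dimension bound -/

section Bound

/-- **`dim 𝔤𝔩(W)_{det_{m+1}} ≤ 2(m+1)² − 2`**: an element of the annihilator vanishing on the
`2(m+1)² − 2` reference entries — the diagonal cells `(r+1,0)`, `(0,c)` (`c ≠ last`), one entry
`X_{(0,l),(0,j)}` per pair `l ≠ j` and one entry `X_{(k,0),(i,0)}` per pair `k ≠ i` — is zero, so
the restriction map to these coordinates is injective on `glAnn det`.
[cite: Burgisser2024Completeness, §7.1 eq. (7.1)] -/
theorem finrank_glAnn_detPoly_succ_le (m : ℕ) :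
    Module.finrank ℂ (glAnn (detPoly (Fin (m + 1)) ℂ)) ≤ 2 * (m + 1) ^ 2 - 2 := by
  classical
  set OD := (Finset.univ : Finset (Fin (m + 1))).offDiag with hOD
  let ref : Fin m ⊕ Fin m ⊕ OD ⊕ OD →
      ((Fin (m + 1) × Fin (m + 1)) × (Fin (m + 1) × Fin (m + 1))) :=
    Sum.elim (fun r => ((r.succ, 0), (r.succ, 0)))
      (Sum.elim (fun c => ((0, c.castSucc), (0, c.castSucc)))
        (Sum.elim (fun p => ((0, p.1.1), (0, p.1.2))) (fun p => ((p.1.1, 0), (p.1.2, 0)))))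
  let L : Matrix (Fin (m + 1) × Fin (m + 1)) (Fin (m + 1) × Fin (m + 1)) ℂ →ₗ[ℂ]
      (Fin m ⊕ Fin m ⊕ OD ⊕ OD → ℂ) :=
    { toFun := fun M x => M (ref x).1 (ref x).2
      map_add' := fun M N => rfl
      map_smul' := fun c M => rfl }
  have hmemOD : ∀ {u v : Fin (m + 1)}, u ≠ v → (u, v) ∈ OD := fun huv => by
    rw [hOD, Finset.mem_offDiag]
    exact ⟨Finset.mem_univ _, Finset.mem_univ _, huv⟩
  have hinj : ∀ M ∈ glAnn (detPoly (Fin (m + 1)) ℂ), L M = 0 → M = 0 := by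
    intro M hM hL
    have href : ∀ x, M (ref x).1 (ref x).2 = 0 := fun x => congr_fun hL x
    ext ⟨k, l⟩ ⟨i, j⟩
    rw [Matrix.zero_apply]
    by_cases hki : k = i
    · subst hki
      by_cases hlj : l = j
      · subst hlj
        exact diag_eq_zero (β := fun r c => M (r, c) (r, c)) (sum_diag_perm_eq_zero hM)
          (fun r => href (Sum.inl r)) (fun c => href (Sum.inr (Sum.inl c))) k l
      · have h0 : M (0, l) (0, j) = 0 := href (Sum.inr (Sum.inr (Sum.inl ⟨(l, j), hmemOD hlj⟩)))
        by_cases hk : k = 0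
        · rw [hk]; exact h0
        · exact entry_eq_zero_of_row_ref hM hk hlj h0
    · by_cases hlj : l = j
      · subst hlj
        have h0 : M (k, 0) (i, 0) = 0 := href (Sum.inr (Sum.inr (Sum.inr ⟨(k, i), hmemOD hki⟩)))
        by_cases hl : l = 0
        · rw [hl]; exact h0
        · exact entry_eq_zero_of_col_ref hM hl hki h0
      · exact entry_eq_zero_of_ne_of_ne hM hki hlj
  have hker : Function.Injective (L.domRestrict (glAnn (detPoly (Fin (m + 1)) ℂ))) := by
    rintro ⟨M, hM⟩ ⟨N, hN⟩ h
    simp only [LinearMap.domRestrict_apply] at h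
    have hMN : M - N = 0 :=
      hinj (M - N) (Submodule.sub_mem _ hM hN) (by rw [map_sub, h, sub_self])
    exact Subtype.ext (sub_eq_zero.1 hMN)
  have hle := LinearMap.finrank_le_finrank_of_injective hker
  rw [Module.finrank_fintype_fun_eq_card, Fintype.card_sum, Fintype.card_sum, Fintype.card_sum,
    Fintype.card_fin, Fintype.card_coe, hOD, Finset.offDiag_card, Finset.card_univ,
    Fintype.card_fin] at hle
  have hX : (m + 1) * (m + 1) - (m + 1) = m * (m + 1) := by
    rw [show (m + 1) * (m + 1) = m * (m + 1) + (m + 1) by ring, Nat.add_sub_cancel]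
  rw [hX] at hle
  have h2 : 2 * (m + 1) ^ 2 = m + (m + (m * (m + 1) + m * (m + 1))) + 2 := by ring
  omega

end Bound

end DetAnnUpper

/-- **`dim 𝔤𝔩(W)_{det_n} ≤ 2n² − 2`** (infinitesimal Frobenius; the hard half of
«`dim H = 2n² − 2`», Bürgisser 2024 (7.1), with `𝔤𝔩(W)_{det_n} = Lie H`): every `X ∈ 𝔤𝔩(ℂ^{n×n})` with
`∑_{a,b} X_{ab} x_a ∂_b det_n = 0` is determined by `2n² − 2` reference entries. Together with the
family `X ↦ AX + XB`, `tr A + tr B = 0` (the easy half) this gives equality.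
[cite: Burgisser2024Completeness, §7.1 eq. (7.1)] [cite: LandsbergManivelRessayre2013, §3.5 (p. 481)] -/
theorem finrank_glAnn_detPoly_le (n : ℕ) :
    Module.finrank ℂ (glAnn (detPoly (Fin n) ℂ)) ≤ 2 * n ^ 2 - 2 := by
  cases n with
  | zero =>
    refine (Submodule.finrank_le _).trans ?_
    rw [Module.finrank_matrix]
    simp
  | succ m => exact DetAnnUpper.finrank_glAnn_detPoly_succ_le m

/-- **`dim 𝔤𝔩(W)·det_n ≥ n⁴ − (2n² − 2)`**: the tangent space of the orbit `GL_{n²}·det_n` has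
dimension at least `n⁴ − 2n² + 2` (rank–nullity `finrank_glTangent_add_finrank_glAnn` and
`finrank_glAnn_detPoly_le`); this is the count behind Bürgisser 2024 §7.2
«`dim Ω_n = dim GL_{n²} − dim H = n⁴ − 2n² + 2`». [cite: Burgisser2024Completeness, §7.2] -/
theorem finrank_glTangent_detPoly_ge (n : ℕ) :
    n ^ 4 - (2 * n ^ 2 - 2) ≤ Module.finrank ℂ (glTangent (detPoly (Fin n) ℂ)) := by
  have h := finrank_glTangent_add_finrank_glAnn (detPoly (Fin n) ℂ)
  rw [Fintype.card_prod, Fintype.card_fin] at h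
  have h2 := finrank_glAnn_detPoly_le n
  have h4 : (n * n) ^ 2 = n ^ 4 := by ring
  omega


end Literature.Computability.AlgebraicComplexity

end
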